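/-
Copyright (c) 2026. All rights reserved.
Released under Apache 2.0 license as described in the file LICENSE.
Authors: abc-iut cell, prover seat abc-iut-L4-d2 (gen 6).
-/
import Literature.AnabelianGeometry.AbsoluteAnabelian.ProfiniteVirtualChartsExtension
import Literature.AnabelianGeometry.AbsoluteAnabelian.NeukirchUchidaInnerAutomorphisms
import HarnessLib

/-!
# Virtual charts III: the hypotheses (NU) and (SLIM) DISCHARGED at `Γ = G_ℚ`

`ProfiniteVirtualCharts.lean` / `ProfiniteVirtualChartsExtension.lean` develop «virtual charts» of compact
groups into a compact Hausdorff group `Γ` under two explicit hypotheses: (NU) every topological isomorphism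
between open subgroups of `Γ` is inner; (SLIM) the centraliser of an open subgroup of `Γ` is trivial.  At
`Γ = G_ℚ = Gal(ℚ̄/ℚ)` (Mathlib `Field.absoluteGaloisGroup ℚ`) BOTH are theorems of the tree — the
Neukirch–Uchida `ℚ`-core with its unique conjugator,
`NeukirchUchidaProof.existsUnique_conj_of_continuousMulEquiv` ([NSW] Thm (12.2.1); cell sub-DAG
`plan/L4/SUBDAG-NeukirchUchida.md`, apex `neukirchUchida_holds`; inner form abc-iut-f-072).  This PROOF-ONLY
file records the discharges `rat_hNU`, `rat_hslim` and the resulting HYPOTHESIS-FREE statements for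
`ℚ`-charts `m : P →ₜ* G_ℚ` of compact groups:

* `Rat.exists_conj_of_charts` — two `ℚ`-charts of `P` are `G_ℚ`-conjugate;
* `Rat.chart_comp_of_openInjective` — `ℚ`-charts pull back along open injections;
* `Rat.exists_chart_extension` — `ℚ`-charts extend along open injections (commensurator construction);
* `Rat.exists_extension_of_openSubgroup` — an open embedding `V ↪ G_ℚ` of an open subgroup `V ≤ P` extends
  to `P →ₜ* G_ℚ`.

These feed the `mapProVal` field of the number-field shadow `GlobalAnabelianContext`
(`GaloisTheatersNumberFieldShadowContext.lean`; [AbsTopIII] Def 5.1 (ii)/(iii), S. Mochizuki, *Topics in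
absolute anabelian geometry III* [MochizukiAbsTopIII2015] pp. 114–115).  Classical; outside the [IUTchIII]
Cor. 3.12 cone; nothing here is an abc claim.
-/

noncomputable section

namespace Literature.AnabelianGeometry.AbsoluteAnabelian

namespace VirtualChart

open Field

universe v w

/-- **(NU) at `Γ = G_ℚ`**: every topological isomorphism between open subgroups of `Gal(ℚ̄/ℚ)` is the
restriction of an inner automorphism (Neukirch–Uchida, `ℚ`-core).
[cite: NeukirchSchmidtWingberg2008, Thm (12.2.1)] -/
theorem rat_hNU : ∀ (U₁ U₂ : Subgroup (absoluteGaloisGroup ℚ)),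
    IsOpen (U₁ : Set (absoluteGaloisGroup ℚ)) → IsOpen (U₂ : Set (absoluteGaloisGroup ℚ)) →
    ∀ α : U₁ ≃ₜ* U₂, ∃ τ : absoluteGaloisGroup ℚ,
      ∀ u : U₁, ((α u : U₂) : absoluteGaloisGroup ℚ) = τ * u * τ⁻¹ :=
  fun _ _ h₁ h₂ α => (NeukirchUchidaProof.existsUnique_conj_of_continuousMulEquiv h₁ h₂ α).exists

/-- **(SLIM) at `Γ = G_ℚ`**: an element of `Gal(ℚ̄/ℚ)` centralising an open subgroup is trivial (the
uniqueness clause of the `ℚ`-core at the identity of `U`). [cite: MochizukiAbsAnab2004, Thm 1.1.1 (ii) p.6] -/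
theorem rat_hslim : ∀ (U : Subgroup (absoluteGaloisGroup ℚ)), IsOpen (U : Set (absoluteGaloisGroup ℚ)) →
    ∀ x : absoluteGaloisGroup ℚ, (∀ u ∈ U, x * u * x⁻¹ = u) → x = 1 := by
  intro U hU x hx
  obtain ⟨τ, -, huniq⟩ :=
    NeukirchUchidaProof.existsUnique_conj_of_continuousMulEquiv hU hU (ContinuousMulEquiv.refl U)
  have h1 : (1 : absoluteGaloisGroup ℚ) = τ := huniq 1 fun u => by
    change ((u : U) : absoluteGaloisGroup ℚ) = 1 * u * 1⁻¹
    group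
  have hx' : x = τ := huniq x fun u => by
    change ((u : U) : absoluteGaloisGroup ℚ) = x * u * x⁻¹
    exact (hx u u.2).symm
  rw [hx', ← h1]

namespace Rat

variable {P : Type v} [Group P] [TopologicalSpace P] [IsTopologicalGroup P] [CompactSpace P]

/-- **Two `ℚ`-charts of a compact group are `G_ℚ`-conjugate** (hypothesis-free).
[cite: NeukirchSchmidtWingberg2008, Thm (12.2.1)] -/
theorem exists_conj_of_charts (m m' : P →ₜ* absoluteGaloisGroup ℚ)
    (hm : ∃ W : Subgroup P, IsOpen (W : Set P) ∧ Set.InjOn m W ∧ IsOpen (m '' W))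
    (hm' : ∃ W : Subgroup P, IsOpen (W : Set P) ∧ Set.InjOn m' W ∧ IsOpen (m' '' W)) :
    ∃ τ : absoluteGaloisGroup ℚ, ∀ p : P, m' p = τ * m p * τ⁻¹ :=
  VirtualChart.exists_conj_of_charts rat_hNU rat_hslim m m' hm hm'

/-- **An open embedding `V ↪ G_ℚ` of an open subgroup of a compact group extends to `P →ₜ* G_ℚ`**
(commensurator construction, hypothesis-free). [cite: NeukirchSchmidtWingberg2008, Thm (12.2.1)] -/
theorem exists_extension_of_openSubgroup {V : Subgroup P} (hV : IsOpen (V : Set P))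
    (e : V →ₜ* absoluteGaloisGroup ℚ) (he : Function.Injective e) (heo : IsOpen (Set.range e)) :
    ∃ m : P →ₜ* absoluteGaloisGroup ℚ, ∀ v : V, m v = e v :=
  VirtualChart.exists_extension_of_openSubgroup rat_hNU rat_hslim hV e he heo

variable {P₁ : Type v} [Group P₁] [TopologicalSpace P₁] [IsTopologicalGroup P₁] [CompactSpace P₁]
variable {P₂ : Type w} [Group P₂] [TopologicalSpace P₂] [IsTopologicalGroup P₂] [CompactSpace P₂]
  [T2Space P₂]

omit [IsTopologicalGroup P₁] [CompactSpace P₁] [T2Space P₂] in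
/-- **`ℚ`-charts pull back along open injections** (hypothesis-free restatement).
[cite: MochizukiAbsTopIII2015, Def 5.1 (iii) p.115] -/
theorem chart_comp_of_openInjective (ι : P₁ →ₜ* P₂) (hι : Function.Injective ι)
    (hιo : IsOpen (Set.range ι)) (m : P₂ →ₜ* absoluteGaloisGroup ℚ)
    (hm : ∃ W : Subgroup P₂, IsOpen (W : Set P₂) ∧ Set.InjOn m W ∧ IsOpen (m '' W)) :
    ∃ W : Subgroup P₁, IsOpen (W : Set P₁) ∧ Set.InjOn (m.comp ι) W ∧ IsOpen ((m.comp ι) '' W) :=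
  VirtualChart.chart_comp_of_openInjective ι hι hιo m hm

/-- **`ℚ`-charts extend along open injections** `ι : P₁ ↪ P₂` of compact groups (hypothesis-free).
[cite: MochizukiAbsTopIII2015, Def 5.1 (iii) p.115] -/
theorem exists_chart_extension (ι : P₁ →ₜ* P₂) (hι : Function.Injective ι)
    (hιo : IsOpen (Set.range ι)) (m₁ : P₁ →ₜ* absoluteGaloisGroup ℚ)
    (hm₁ : ∃ W : Subgroup P₁, IsOpen (W : Set P₁) ∧ Set.InjOn m₁ W ∧ IsOpen (m₁ '' W)) :
    ∃ m₂ : P₂ →ₜ* absoluteGaloisGroup ℚ,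
      (∃ W : Subgroup P₂, IsOpen (W : Set P₂) ∧ Set.InjOn m₂ W ∧ IsOpen (m₂ '' W)) ∧
        ∀ x : P₁, m₂ (ι x) = m₁ x :=
  VirtualChart.exists_chart_extension rat_hNU rat_hslim ι hι hιo m₁ hm₁

/-- **Invariance of «admits a `ℚ`-chart» along open injections, both directions** — the form consumed by
the shadow context's `mapProVal`. [cite: MochizukiAbsTopIII2015, Def 5.1 (iii) p.115] -/
theorem exists_chart_iff_of_openInjective (ι : P₁ →ₜ* P₂) (hι : Function.Injective ι)
    (hιo : IsOpen (Set.range ι)) :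
    (∃ m₁ : P₁ →ₜ* absoluteGaloisGroup ℚ,
        ∃ W : Subgroup P₁, IsOpen (W : Set P₁) ∧ Set.InjOn m₁ W ∧ IsOpen (m₁ '' W)) ↔
      ∃ m₂ : P₂ →ₜ* absoluteGaloisGroup ℚ,
        ∃ W : Subgroup P₂, IsOpen (W : Set P₂) ∧ Set.InjOn m₂ W ∧ IsOpen (m₂ '' W) := by
  constructor
  · rintro ⟨m₁, hm₁⟩
    obtain ⟨m₂, hm₂, -⟩ := exists_chart_extension ι hι hιo m₁ hm₁
    exact ⟨m₂, hm₂⟩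
  · rintro ⟨m₂, hm₂⟩
    exact ⟨m₂.comp ι, chart_comp_of_openInjective ι hι hιo m₂ hm₂⟩

end Rat

end VirtualChart

end Literature.AnabelianGeometry.AbsoluteAnabelian

end
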